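import Summits.Ventures.HodgeRepro.Tier3LemmaRGenerator

/-!
# A toy instance of LEMMA R's data: `K = ℂ` over `F₀ = ℝ`, one isogeny class, two corners twisted by `1` and complex
conjugation — the hypotheses of `Tier3LemmaRGenerator.exists_weil_line_generator` are satisfiable with a
NON-TRIVIAL twist, and its conclusion instantiates

Blind re-derivation cell `pub-hodge-repro`, seat `t3-p4` (Tier 3, T3.5 for T3.4 = Lemma R).  Target tree path
`lean/Summits/Ventures/HodgeRepro/Tier3LemmaRExample.lean`; imports the cell's `Tier3LemmaRGenerator`.

WHAT THIS FILE STATES.  The abstract theorems of this seat quantify over a finite Galois extension `K/F₀`, a face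
`(cls, tw)` with `(cls, tw)` injective and `|ι| = 2k`, bases `ω`, `ω′` and a pull-back `M` with
`M (c • ω_j) = Σ_{cls i = j} (tw i)⁻¹(c) • ω′_i`, plus linear orders and the left-multiplication actions on
`J × Gal`, `ι × Gal`.  `weilLine_toy` exhibits all of it in the smallest non-trivial case — `F₀ = ℝ`, `K = ℂ`
(Galois of degree `2`, `Gal = {1, conj}`), `J = Fin 1`, `ι = Fin 2`, `cls = 0`, `tw = (1, conj)`, `V_red = ℂ`,
`V_B = ℂ²`, `M c = (c, c̄)` — and reads off `exists_weil_line_generator`: the Weil line `W ≤ ⋀²_ℝ ℂ²` is an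
`ℝ`-subspace of dimension `2 = [ℂ : ℝ]`, and for `W_red = ⊤` (every class of `⋀²_ℝ ℂ` is «Hodge» in the toy) there is
`η ≠ 0` with `e₀ (⋀² M η) ∈ W` non-zero generating `W` under `act(a) = ⋀²(a on the first corner)`.  So the
hypotheses of the abstract theorems are not vacuous, and the twist `conj ≠ 1` within one class is exercised.

HONESTY.  A toy over `ℝ`, not a CM abelian variety: nothing here is about cohomology, and `W_red = ⊤` stands in for
the Pohlmann subspace.  No definition is introduced (the instances are built inside the proof and exported in the
conclusion).  HC_CM is NOT proved by anyone in this repository.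
-/

set_option autoImplicit false

open TensorProduct Finset

namespace HodgeRepro.Tier3

open HodgeRepro.RouteC HodgeRepro.CMHodgeOn

/-- `ℂ/ℝ` is Galois: `ℂ` is an algebraic closure of `ℝ` and `ℝ` has characteristic zero. -/
theorem isGalois_real_complex : IsGalois ℝ ℂ := by
  haveI : IsAlgClosure ℝ ℂ := ⟨Complex.isAlgClosed, Algebra.IsAlgebraic.of_finite ℝ ℂ⟩
  infer_instance

/-- Complex conjugation is a non-trivial element of `Gal(ℂ/ℝ)`. -/
theorem conjAe_ne_one : (Complex.conjAe : ℂ ≃ₐ[ℝ] ℂ) ≠ 1 := by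
  intro h
  have h1 : Complex.conjAe Complex.I = Complex.I := by rw [h, AlgEquiv.one_apply]
  rw [Complex.conjAe_coe, Complex.conj_I] at h1
  exact Complex.I_ne_zero (by linear_combination (-(1 : ℂ) / 2) * h1)

/-- **The toy instance.**  With `F₀ = ℝ`, `K = ℂ`, `J = Fin 1`, `ι = Fin 2`, `cls = 0`, `tw = (1, conj)`,
`ω = (1)`, `ω′` the standard basis of `ℂ²` and `M c = (c, c̄)`, the hypotheses of `exists_weil_line_generator` hold
(for the exhibited linear orders and left-multiplication actions), and its conclusion gives the Weil line
`W ≤ ⋀²_ℝ ℂ²` of `ℝ`-dimension `2` with a generator `e₀ (⋀² M η)`, `η ≠ 0`. -/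
theorem weilLine_toy :
    ∃ (M : ℂ →ₗ[ℝ] (Fin 2 → ℂ)) (tw : Fin 2 → (ℂ ≃ₐ[ℝ] ℂ)),
      tw 0 ≠ tw 1 ∧
      (∀ c : ℂ, M c = ![c, tw 1 c]) ∧
      ∃ (W : Submodule ℝ (⋀[ℝ]^(2 * 1) (Fin 2 → ℂ)))
        (e₀ : ⋀[ℝ]^(2 * 1) (Fin 2 → ℂ) →ₗ[ℝ] ⋀[ℝ]^(2 * 1) (Fin 2 → ℂ)),
        Module.finrank ℝ W = 2 ∧ (∀ v, e₀ v ∈ W) ∧ (∀ w ∈ W, e₀ w = w) ∧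
        ∃ η : ⋀[ℝ]^(2 * 1) ℂ, η ≠ 0 ∧ e₀ (exteriorPower.map (2 * 1) M η) ≠ 0 ∧
          ∀ x ∈ W, ∃ a : ℂ, x = exteriorPower.map (2 * 1)
            (((Pi.basisFun ℂ (Fin 2)).constr ℂ fun i =>
              Function.update (fun _ => (1 : ℂ)) 0 a i • Pi.basisFun ℂ (Fin 2) i).restrictScalars ℝ)
            (e₀ (exteriorPower.map (2 * 1) M η)) := by
  classical
  haveI : IsGalois ℝ ℂ := isGalois_real_complex
  -- the data
  let tw : Fin 2 → (ℂ ≃ₐ[ℝ] ℂ) := ![1, Complex.conjAe]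
  let cls : Fin 2 → Fin 1 := fun _ => 0
  let ω : Module.Basis (Fin 1) ℂ ℂ := Module.Basis.singleton (Fin 1) ℂ
  let ω' : Module.Basis (Fin 2) ℂ (Fin 2 → ℂ) := Pi.basisFun ℂ (Fin 2)
  let M : ℂ →ₗ[ℝ] (Fin 2 → ℂ) := LinearMap.pi ![LinearMap.id, Complex.conjAe.toLinearMap]
  have hMapply : ∀ c : ℂ, M c = ![c, tw 1 c] := by
    intro c
    funext i
    fin_cases i <;> rfl
  have htw : tw 0 ≠ tw 1 := by
    change (1 : ℂ ≃ₐ[ℝ] ℂ) ≠ Complex.conjAe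
    exact conjAe_ne_one.symm
  have hinj : Function.Injective fun i : Fin 2 => (cls i, tw i) := by
    intro i j h
    have h2 : tw i = tw j := (Prod.mk.inj h).2
    fin_cases i <;> fin_cases j <;> first | rfl | exact absurd h2 htw | exact absurd h2.symm htw
  have hcard : Fintype.card (Fin 2) = 2 * 1 := by simp
  have hM : ∀ (c : ℂ) (j : Fin 1),
      M (c • ω j) = ∑ i ∈ univ.filter (fun i => cls i = j), ((tw i)⁻¹ c) • ω' i := by
    intro c j
    have hj : j = 0 := Subsingleton.elim _ _
    subst hj
    have hfilter : (univ.filter fun i : Fin 2 => cls i = 0) = univ := by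
      ext i
      simp [cls]
    rw [hfilter, Fin.sum_univ_two]
    funext i
    fin_cases i
    · simp [M, ω, ω', tw, Module.Basis.singleton_apply]
    · simp [M, ω, ω', tw, Module.Basis.singleton_apply]
      rfl
  -- the orders and the actions
  letI : LinearOrder (Fin 1 × (ℂ ≃ₐ[ℝ] ℂ)) :=
    LinearOrder.lift' (fun p => ((Fintype.equivFin (Fin 1 × (ℂ ≃ₐ[ℝ] ℂ))) p : ℕ))
      (fun a b h => (Fintype.equivFin _).injective (Fin.ext h))
  letI : LinearOrder (Fin 2 × (ℂ ≃ₐ[ℝ] ℂ)) :=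
    LinearOrder.lift' (fun p => ((Fintype.equivFin (Fin 2 × (ℂ ≃ₐ[ℝ] ℂ))) p : ℕ))
      (fun a b h => (Fintype.equivFin _).injective (Fin.ext h))
  letI : SMul (ℂ ≃ₐ[ℝ] ℂ) (Fin 1 × (ℂ ≃ₐ[ℝ] ℂ)) := ⟨fun σ p => (p.1, σ * p.2)⟩
  letI : MulAction (ℂ ≃ₐ[ℝ] ℂ) (Fin 1 × (ℂ ≃ₐ[ℝ] ℂ)) :=
    { one_smul := fun p => by show (p.1, 1 * p.2) = p; rw [one_mul]
      mul_smul := fun σ τ p => by show (p.1, (σ * τ) * p.2) = (p.1, σ * (τ * p.2)); rw [mul_assoc] }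
  letI : SMul (ℂ ≃ₐ[ℝ] ℂ) (Fin 2 × (ℂ ≃ₐ[ℝ] ℂ)) := ⟨fun σ p => (p.1, σ * p.2)⟩
  letI : MulAction (ℂ ≃ₐ[ℝ] ℂ) (Fin 2 × (ℂ ≃ₐ[ℝ] ℂ)) :=
    { one_smul := fun p => by show (p.1, 1 * p.2) = p; rw [one_mul]
      mul_smul := fun σ τ p => by show (p.1, (σ * τ) * p.2) = (p.1, σ * (τ * p.2)); rw [mul_assoc] }
  have hact : ∀ (σ x : ℂ ≃ₐ[ℝ] ℂ) (j : Fin 1), σ • (j, x) = (j, σ * x) := fun _ _ _ => rfl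
  have hact' : ∀ (σ x : ℂ ≃ₐ[ℝ] ℂ) (i : Fin 2), σ • (i, x) = (i, σ * x) := fun _ _ _ => rfl
  -- the abstract theorem
  obtain ⟨e, E, Φ, e', E', Φ', W, e₀, -, -, -, -, -, -, -, -, he₀mem, he₀id, -, hdim, hW⟩ :=
    exists_weil_line_generator (F₀ := ℝ) (K := ℂ) cls tw hinj hcard ω ω' M hM hact hact' 0
  refine ⟨M, tw, htw, hMapply, W, e₀, ?_, he₀mem, he₀id, ?_⟩
  · rw [hdim, Complex.finrank_real_complex]
  · obtain ⟨η, -, hη0, -, hw₀ne, hgen⟩ := hW ⊤ (fun _ _ => by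
      rw [Submodule.baseChange_top]; exact Submodule.mem_top)
    exact ⟨η, hη0, hw₀ne, hgen⟩

end HodgeRepro.Tier3
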